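import Summits.ABC.IUTFork.LDHGenuineHullRegimeSlack
import Mathlib.NumberTheory.Chebyshev
import HarnessLib

/-!
# The fork at [IUTchIII] Corollary 3.12, L-DH level, READING (U) — HONEST-SCOPE CERTIFICATE, π-FORM: wherever the slack
# theorem `PointDict.hullVolumeAtDatum_BIII_of_logQAvoid_le` applies, [IUTchIV] Thm. 1.10's display is CONTENT-FREE
# (abc-iut cell, crux ThetaPartII = stmt-ABC-19678, stub `stub_hullRegime` / VERDICT RISK ¶7)

Record-only file (D-0012) of the abc-iut cell (WAVE-3 discharge seat abc-iut-c312-d1, gen 6); TAKES NO SIDE on [IUTchIII]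
Cor. 3.12 or on the (U)/(P) readings. abc-iut-c312-d1 (gen 5) proved the (U)-volume body `Cor22.HullVolumeAtDatum P l (B_III P l)`
WITHOUT slot-constancy under the hypothesis
`log(q^{∤{2,l}}(λ)) ≤ 40·log(d*·l)·(π(d*·l) − C(P,l)/log 2)` (`LDHGenuineHullRegimeSlack`,
`PointDict.hullVolumeAtDatum_BIII_of_logQAvoid_le`; `C(P,l) = 2·d_mod·(log-diff + log 𝔣^{∤{2,l}}) + log(30·l)`,
`d* = 2^12·3^3·5·d_mod`), and recorded the honest scope of that theorem for the CLOSED-FORM Chebyshev-lower-bound threshold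
only (`LDHGenuineHullRegimeTrivialRange`: `Θ_expl ≤ 20·log 2·d*·l`), leaving the π-form hypothesis itself to «numbers, not kernel»
(Rosser–Schoenfeld `π(x) ≤ 1.26·x/log x`). THIS FILE closes that gap in the kernel with Mathlib's explicit Chebyshev UPPER bound
`Chebyshev.pi_le_log4_mul_div` (`π(⌊x⌋) ≤ log 4·x/log √x + √x`):

* `Cor22.forty_mul_log_mul_primeCounting_le` — `40·log N·π(N) ≤ 115·N` for every natural `N ≥ 2 560 000 = 40⁴`
  (`80·log 4 < 110.91`, and `√N·log N ≤ 4·N^{3/4} ≤ N/10` from `log N ≤ 4·N^{1/4}`, `N^{1/4} ≥ 40`);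
* `Cor22.slackThreshold_le` — for `l ≥ 5` the π-form threshold is `≤ 115·d*·l` (`d*·l ≥ 2^12·3^3·5·5 ≥ 40⁴`, `C(P,l) ≥ 0`);
* **`Cor22.display_of_logQAvoid_le_slackThreshold`** — `log(q^{∤{2,l}}(λ)) ≤ 40·log(d*·l)·(π(d*·l) − C(P,l)/log 2) → 0 ≤ η →
  Cor22.Display P l η` (`(1/6)·115 < 20`): the EXACT hypothesis of the slack theorem makes Thm. 1.10's display
  `(1/6)·log q ≤ (1 + 20·d_mod/l)·(log-diff + log 𝔣) + 20·(d*·l + η)` hold OUTRIGHT, with no appeal to Cor. 3.12 in any reading;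
* `PointDict.display_and_hullVolumeAtDatum_of_logQAvoid_le` — the conjunction at admissible `P`, `l ≥ 7`: under that ONE
  hypothesis both the (U)-volume edge (gen 5) and the display it serves (this file) are theorems.

Reading for VERDICT RISK ¶7 (kernel-backed in full now): in reading (U), off the slot-constant regime, the region where the Step
(viii) prime-counting slack absorbs the slot residue is ENTIRELY inside the region where [IUTchIV] Thm. 1.10's display is
content-free (`40·log x·π(x) ≤ 115·x < 120·x` at every `x = d*·l`); wherever the display has content, (ii′)-(U) requires
`slotResidue ≤ B_III − δ_explicit` (abc-iut-S8: forced), an inequality of Szpiro type. Reading (P) is unaffected.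
[cite: Mochizuki2012, IUTchIV Thm. 1.10 p. 22–23; Cor. 2.2 (ii) proof p. 46] [claim: Mochizuki2012, status: disputed] for the
IUT quotations; the content of this file is Chebyshev's bound and elementary real arithmetic.
-/

noncomputable section

namespace Literature.IUT.LogVolume

namespace Cor22

open Literature.NumberTheory.DiophantineGeometry.GenEll

/-! ## 1. Chebyshev's upper bound in the form `40·log N·π(N) ≤ 115·N` -/

/-- Chebyshev, explicit (Mathlib `Chebyshev.pi_le_log4_mul_div` at `x = N`): `π(N) ≤ 2·log 4·N/log N + √N` for `N ≥ 2`.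
[cite: Mochizuki2012, IUTchIV Prop. 1.6 / Prop. 2.1 (ii) p. 40 (the prime number theorem inputs)] -/
theorem primeCounting_le_two_mul_log_four (N : ℕ) (hN : 2 ≤ N) :
    (Nat.primeCounting N : ℝ) ≤ 2 * Real.log 4 * N / Real.log N + Real.sqrt N := by
  have hx : (1 : ℝ) < (N : ℝ) := by exact_mod_cast (lt_of_lt_of_le one_lt_two hN)
  have hN0 : (0 : ℝ) ≤ (N : ℝ) := by positivity
  have h := Chebyshev.pi_le_log4_mul_div hx
  rw [Nat.floor_natCast, Real.log_sqrt hN0] at h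
  have hlogN : 0 < Real.log (N : ℝ) := Real.log_pos hx
  calc (Nat.primeCounting N : ℝ) ≤ Real.log 4 * N / (Real.log N / 2) + Real.sqrt N := h
    _ = 2 * Real.log 4 * N / Real.log N + Real.sqrt N := by field_simp

/-- `log N ≤ 4·N^{1/4}` (`log x ≤ x^ε/ε`). [folklore] -/
theorem log_le_four_mul_rpow_quarter (N : ℕ) (hN : 1 ≤ N) :
    Real.log (N : ℝ) ≤ 4 * (N : ℝ) ^ ((1 : ℝ) / 4) := by
  have hN0 : (0 : ℝ) < (N : ℝ) := by exact_mod_cast hN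
  have h := Real.log_le_rpow_div hN0.le (show (0 : ℝ) < 1 / 4 by norm_num)
  calc Real.log (N : ℝ) ≤ (N : ℝ) ^ ((1 : ℝ) / 4) / (1 / 4) := h
    _ = 4 * (N : ℝ) ^ ((1 : ℝ) / 4) := by ring

/-- `√N·log N ≤ N/10` for `N ≥ 40⁴ = 2 560 000` (`√N·log N ≤ 4·N^{3/4} = 4·N/N^{1/4} ≤ 4·N/40`). [folklore] -/
theorem sqrt_mul_log_le (N : ℕ) (hN : 2560000 ≤ N) :
    Real.sqrt N * Real.log N ≤ (N : ℝ) / 10 := by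
  have hN1 : 1 ≤ N := le_trans (by norm_num) hN
  have hN0 : (0 : ℝ) < (N : ℝ) := by exact_mod_cast hN1
  have hlog := log_le_four_mul_rpow_quarter N hN1
  -- `N^{1/4} ≥ 40`
  have hq : (40 : ℝ) ≤ (N : ℝ) ^ ((1 : ℝ) / 4) := by
    have h40 : (40 : ℝ) = ((2560000 : ℝ)) ^ ((1 : ℝ) / 4) := by
      rw [show (2560000 : ℝ) = 40 ^ (4 : ℝ) by norm_num, ← Real.rpow_mul (by norm_num)]
      norm_num
    rw [h40]
    exact Real.rpow_le_rpow (by norm_num) (by exact_mod_cast hN) (by norm_num)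
  have hsqrt : Real.sqrt (N : ℝ) = (N : ℝ) ^ ((1 : ℝ) / 2) := Real.sqrt_eq_rpow (N : ℝ)
  -- `√N · N^{1/4} · N^{1/4} = N`
  have hprod : (N : ℝ) ^ ((1 : ℝ) / 2) * (N : ℝ) ^ ((1 : ℝ) / 4) * (N : ℝ) ^ ((1 : ℝ) / 4) = N := by
    rw [← Real.rpow_add hN0, ← Real.rpow_add hN0]
    norm_num
  have hs0 : 0 ≤ (N : ℝ) ^ ((1 : ℝ) / 2) := Real.rpow_nonneg hN0.le _
  have hq0 : 0 ≤ (N : ℝ) ^ ((1 : ℝ) / 4) := Real.rpow_nonneg hN0.le _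
  rw [hsqrt]
  -- `√N·log N ≤ √N·4·N^{1/4}` and `40·(√N·N^{1/4}) ≤ √N·N^{1/4}·N^{1/4} = N`
  have h1 : (N : ℝ) ^ ((1 : ℝ) / 2) * Real.log N ≤ (N : ℝ) ^ ((1 : ℝ) / 2) * (4 * (N : ℝ) ^ ((1 : ℝ) / 4)) :=
    mul_le_mul_of_nonneg_left hlog hs0
  have h2 : 40 * ((N : ℝ) ^ ((1 : ℝ) / 2) * (N : ℝ) ^ ((1 : ℝ) / 4)) ≤ N := by
    calc 40 * ((N : ℝ) ^ ((1 : ℝ) / 2) * (N : ℝ) ^ ((1 : ℝ) / 4))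
        ≤ (N : ℝ) ^ ((1 : ℝ) / 4) * ((N : ℝ) ^ ((1 : ℝ) / 2) * (N : ℝ) ^ ((1 : ℝ) / 4)) :=
          mul_le_mul_of_nonneg_right hq (mul_nonneg hs0 hq0)
      _ = (N : ℝ) ^ ((1 : ℝ) / 2) * (N : ℝ) ^ ((1 : ℝ) / 4) * (N : ℝ) ^ ((1 : ℝ) / 4) := by ring
      _ = N := hprod
  nlinarith [h1, h2, mul_nonneg hs0 hq0]

/-- **`40·log N·π(N) ≤ 115·N` for `N ≥ 2 560 000`** (Chebyshev: `π(N) ≤ 2·log 4·N/log N + √N`, `80·log 4 < 110.91`,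
`40·√N·log N ≤ 4·N`). [cite: Mochizuki2012, IUTchIV Prop. 2.1 (ii) p. 40] -/
theorem forty_mul_log_mul_primeCounting_le (N : ℕ) (hN : 2560000 ≤ N) :
    40 * Real.log (N : ℝ) * (Nat.primeCounting N : ℝ) ≤ 115 * (N : ℝ) := by
  have hN2 : 2 ≤ N := le_trans (by norm_num) hN
  have hx : (1 : ℝ) < (N : ℝ) := by exact_mod_cast (lt_of_lt_of_le one_lt_two hN2)
  have hlogN : 0 < Real.log (N : ℝ) := Real.log_pos hx
  have hpi := primeCounting_le_two_mul_log_four N hN2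
  have hsq := sqrt_mul_log_le N hN
  -- `log 4 < 1.3863` (the tree's `Literature.NumberTheory.LFunctions.NicolasCor21RH.log_four_lt`, re-derived inline
  -- from `Real.log_two_lt_d9` to keep the import closure small)
  have hl4 : Real.log 4 < 1.3863 := by
    rw [show (4 : ℝ) = 2 ^ 2 by norm_num, Real.log_pow]
    have := Real.log_two_lt_d9
    push_cast
    linarith
  have hN0 : (0 : ℝ) ≤ (N : ℝ) := by positivity
  -- multiply Chebyshev by `40·log N > 0`
  have h1 : 40 * Real.log (N : ℝ) * (Nat.primeCounting N : ℝ) ≤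
      40 * Real.log (N : ℝ) * (2 * Real.log 4 * N / Real.log N + Real.sqrt N) :=
    mul_le_mul_of_nonneg_left hpi (by positivity)
  have h2 : 40 * Real.log (N : ℝ) * (2 * Real.log 4 * N / Real.log N + Real.sqrt N) =
      80 * Real.log 4 * N + 40 * (Real.sqrt N * Real.log N) := by
    field_simp
    ring
  rw [h2] at h1
  have hl40 : 0 ≤ Real.log 4 := Real.log_nonneg (by norm_num)
  nlinarith [h1, hsq, hl4, hN0, mul_nonneg hl40 hN0]

/-! ## 2. The π-form slack threshold is below `115·d*·l`, hence inside the content-free range of the display -/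

variable {P : NFPoint} {l : ℕ}

/-- **The π-form threshold of `PointDict.hullVolumeAtDatum_BIII_of_logQAvoid_le` is at most `115·d*·l`** for `l ≥ 5`
(`d*·l ≥ 2^12·3^3·5·5 ≥ 40⁴`, `C(P,l) ≥ 0`, §1). [cite: Mochizuki2012, IUTchIV Thm. 1.10 p. 22] -/
theorem slackThreshold_le (hl : 5 ≤ l) :
    40 * Real.log (((2 ^ 12 * 3 ^ 3 * 5 * Cor22.dmod P : ℕ) : ℝ) * l)
        * ((Nat.primeCounting (2 ^ 12 * 3 ^ 3 * 5 * Cor22.dmod P * l) : ℝ)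
          - (2 * (Cor22.dmod P : ℝ) * (P.logDiff + Cor22.logCondAvoid P {2, l}) + Real.log (2 * 3 * 5 * (l : ℝ)))
            / Real.log 2) ≤
      115 * (((2 ^ 12 * 3 ^ 3 * 5 * Cor22.dmod P * l : ℕ) : ℝ)) := by
  have hd : 1 ≤ Cor22.dmod P := Cor22.dmod_pos P
  set N : ℕ := 2 ^ 12 * 3 ^ 3 * 5 * Cor22.dmod P * l with hN
  have hNge : 2560000 ≤ N := by
    rw [hN]
    calc 2560000 ≤ 2 ^ 12 * 3 ^ 3 * 5 * 1 * 5 := by norm_num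
      _ ≤ 2 ^ 12 * 3 ^ 3 * 5 * Cor22.dmod P * l := by gcongr
  have hcast : (((2 ^ 12 * 3 ^ 3 * 5 * Cor22.dmod P : ℕ) : ℝ) * l) = (N : ℝ) := by rw [hN]; push_cast; ring
  rw [hcast]
  have hx : (1 : ℝ) < (N : ℝ) := by exact_mod_cast (lt_of_lt_of_le (by norm_num) hNge)
  have hlogN : 0 < Real.log (N : ℝ) := Real.log_pos hx
  -- `C(P,l) ≥ 0`
  have hC : 0 ≤ (2 * (Cor22.dmod P : ℝ) * (P.logDiff + Cor22.logCondAvoid P {2, l}) + Real.log (2 * 3 * 5 * (l : ℝ)))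
      / Real.log 2 := by
    have hl' : (5 : ℝ) ≤ l := by exact_mod_cast hl
    have h1 : 0 ≤ Real.log (2 * 3 * 5 * (l : ℝ)) := Real.log_nonneg (by linarith)
    have h2 : 0 ≤ P.logDiff + Cor22.logCondAvoid P {2, l} := add_nonneg P.logDiff_nonneg (Cor22.logCondAvoid_nonneg P _)
    have hlog2 : (0 : ℝ) < Real.log 2 := Real.log_pos (by norm_num)
    positivity
  -- drop `C`, then §1
  have h1 : 40 * Real.log (N : ℝ) * ((Nat.primeCounting N : ℝ)
        - (2 * (Cor22.dmod P : ℝ) * (P.logDiff + Cor22.logCondAvoid P {2, l}) + Real.log (2 * 3 * 5 * (l : ℝ)))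
          / Real.log 2) ≤
      40 * Real.log (N : ℝ) * (Nat.primeCounting N : ℝ) :=
    mul_le_mul_of_nonneg_left (by linarith) (by positivity)
  exact h1.trans (forty_mul_log_mul_primeCounting_le N hNge)

/-- **HONEST-SCOPE CERTIFICATE, π-FORM: under the EXACT hypothesis of the slack theorem, [IUTchIV] Thm. 1.10's display holds
OUTRIGHT.** For any `λ`-line point `P`, `l ≥ 5`, `η ≥ 0`: if
`log(q^{∤{2,l}}(λ)) ≤ 40·log(d*·l)·(π(d*·l) − C(P,l)/log 2)` (the hypothesis `h` of
`Summit.ABC.IUTFork.PointDict.hullVolumeAtDatum_BIII_of_logQAvoid_le`), then `Cor22.Display P l η` — because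
`(1/6)·log q ≤ (115/6)·d*·l < 20·d*·l ≤ (1 + 20·d_mod/l)·(log-diff + log 𝔣) + 20·(d*·l + η)`. So the whole height range in
which the kernel proves the volume edge (ii′) in reading (U) without slot-constancy is a range in which the inequality it serves
is content-free. [cite: Mochizuki2012, IUTchIV Thm. 1.10 p. 22–23] [claim: Mochizuki2012, status: disputed] -/
theorem display_of_logQAvoid_le_slackThreshold (hl : 5 ≤ l)
    (h : Cor22.logQAvoid P {2, l} ≤
      40 * Real.log (((2 ^ 12 * 3 ^ 3 * 5 * Cor22.dmod P : ℕ) : ℝ) * l)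
        * ((Nat.primeCounting (2 ^ 12 * 3 ^ 3 * 5 * Cor22.dmod P * l) : ℝ)
          - (2 * (Cor22.dmod P : ℝ) * (P.logDiff + Cor22.logCondAvoid P {2, l}) + Real.log (2 * 3 * 5 * (l : ℝ)))
            / Real.log 2))
    {η : ℝ} (hη : 0 ≤ η) : Cor22.Display P l η := by
  have hΘ := h.trans (slackThreshold_le (P := P) hl)
  have hcast : (((2 ^ 12 * 3 ^ 3 * 5 * Cor22.dmod P * l : ℕ) : ℝ)) = 2 ^ 12 * 3 ^ 3 * 5 * (Cor22.dmod P : ℝ) * l := by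
    push_cast; ring
  rw [hcast] at hΘ
  unfold Cor22.Display
  have hLD : 0 ≤ P.logDiff + Cor22.logCondAvoid P {2, l} := add_nonneg P.logDiff_nonneg (Cor22.logCondAvoid_nonneg P _)
  have hl' : (5 : ℝ) ≤ l := by exact_mod_cast hl
  have hd : (1 : ℝ) ≤ Cor22.dmod P := by exact_mod_cast Cor22.dmod_pos P
  have hcoef : 0 ≤ 1 + 20 * (Cor22.dmod P : ℝ) / l := by positivity
  have hN0 : 0 ≤ (2 : ℝ) ^ 12 * 3 ^ 3 * 5 * (Cor22.dmod P : ℝ) * l := by positivity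
  nlinarith [mul_nonneg hcoef hLD, hN0, hΘ, hη]

end Cor22

end Literature.IUT.LogVolume

namespace Summit.ABC.IUTFork

namespace PointDict

open Literature.IUT.LogVolume Literature.NumberTheory.DiophantineGeometry.GenEll

variable {P : NFPoint} {l : ℕ}

/-- **Under the ONE hypothesis of the slack theorem, BOTH the (U)-volume edge (ii′) and [IUTchIV] Thm. 1.10's display are
theorems** (admissible `P`, `l ≥ 7`, `η ≥ 0`): abc-iut-c312-d1 gen 5 `hullVolumeAtDatum_BIII_of_logQAvoid_le` ∧ this file's
`Cor22.display_of_logQAvoid_le_slackThreshold`. The kernel form of VERDICT RISK ¶7's honest-scope clause: the slack never buys a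
contentful instance of the display. [cite: Mochizuki2012, IUTchIV Thm. 1.10 p. 22–23] [claim: Mochizuki2012, status: disputed] -/
theorem display_and_hullVolumeAtDatum_of_logQAvoid_le (hP : P ∈ UP) (h7 : 7 ≤ l)
    (h : Cor22.logQAvoid P {2, l} ≤
      40 * Real.log (((2 ^ 12 * 3 ^ 3 * 5 * Cor22.dmod P : ℕ) : ℝ) * l)
        * ((Nat.primeCounting (2 ^ 12 * 3 ^ 3 * 5 * Cor22.dmod P * l) : ℝ)
          - (2 * (Cor22.dmod P : ℝ) * (P.logDiff + Cor22.logCondAvoid P {2, l}) + Real.log (2 * 3 * 5 * (l : ℝ)))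
            / Real.log 2))
    {η : ℝ} (hη : 0 ≤ η) :
    Cor22.Display P l η ∧
      Cor22.HullVolumeAtDatum P l (((l : ℝ) + 1) / 4 * ((1 + 12 * (Cor22.dmod P : ℝ) / l)
        * (P.logDiff + Cor22.logCondAvoid P {2, l}) + 2 * Real.log l + 52
          + 20 / 3 * Real.log (((2 ^ 12 * 3 ^ 3 * 5 * Cor22.dmod P : ℕ) : ℝ) * (l : ℝ))
            * (Nat.primeCounting (2 ^ 12 * 3 ^ 3 * 5 * Cor22.dmod P * l) : ℝ))) :=
  ⟨Cor22.display_of_logQAvoid_le_slackThreshold (le_trans (by norm_num) h7) h hη,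
    hullVolumeAtDatum_BIII_of_logQAvoid_le hP h7 h⟩

end PointDict

end Summit.ABC.IUTFork

end
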